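import Summits.ResolutionOfSingularities.ResolutionOfSingularities.Theorems.HilbertSamuelEliminationSigmaMaxModificationsCorridor3CPFramePropagationWaiting
import Summits.ResolutionOfSingularities.ResolutionOfSingularities.Theorems.HilbertSamuelEliminationSigmaMaxModificationsCorridor3CPFrameMenuChainAny
import HarnessLib

/-!
# [OURS · L1 W4.2] D18 `hread_menu` — FINAL PACKAGING: E-adapted complete minimal CP frames with `δ ≥ 1` along the boundary-threaded canonical
# chain, given only the initial frame and, at the steps THROUGH the marked point, the face shape of the canonical centre
# (cell res-hironaka, LADDER-RESOLUTION rung L; slot W4.2, crux chain w42 `SigmaMaxModificationsCorridor3` stmt-ResolutionOfSingularities-19249;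
# `--supports stmt-ResolutionOfSingularities-19249 --as helper`; hand res-D-brk-3 (gen 7), file F3g = F3e ∘ F3f)

SCHEME-SIDE BOOKKEEPING (universe `0`), 0 `def`s, every declaration PROVED; OURS; NOT a statement of Hironaka's manuscript [Hironaka2017] nor of
[CossartJannsenSaito2020]/[CossartPiltant2019]. AI-written, weaker than expert review.

* **`exists_isCPFrame_adapted_of_reachesσE_through'`** — the chain of `…CPFramePropagationWaiting` with the binder `hread` receiving, besides
  `x_n ∈ V(C)`, the PERMISSIBILITY of `C` at `x_n` (derived inside the induction from the successor point by
  `isPermissibleAt_of_isCanonicalStep_of_mem`).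
* **`exists_isCPFrame_adapted_of_reachesσE_through_of_faces`** — `hread_menu` DISCHARGED: the only binders are `h0` (an E₀-adapted complete
  minimal CP frame with `δ ≥ 1` at the origin — res-D-pv-060's `hbirth`) and `hface`: at every reached stage and every canonical centre `C`
  THROUGH `x_n`, some finite set `K` of boundary members through `x_n` with pairwise distinct stalks has `𝓘_I ≤ 𝓘_C` (`I ∈ K`) and
  `dim 𝒪_{x_n}/𝓘_C + |K| = 3` (points `|K| = 3` or see `IsCPFrame.reading_of_face_univ`, member curves `|K| = 2`, member surfaces `|K| = 1`).
  No characteristic, projection or permissibility hypothesis: equicharacteristic stalks by `natCast_eq_zero_or_isUnit_stalk_of_reachesσE`,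
  CP Prop. 2.4 lifting by `…CPFrameFaceVertexAny`, permissibility by the canonical process.

References: CP 2019 Def. 2.6–2.7, Prop. 2.3–2.4, Prop. 2.7 [CossartPiltant2019]; CJS LNM 2270 Def. 3.1, Rem. 6.29 (1) [CossartJannsenSaito2020].
-/

noncomputable section

set_option linter.dupNamespace false

open CategoryTheory AlgebraicGeometry TopologicalSpace IsLocalRing Polynomial
open Literature.AlgebraicGeometry.Resolution Literature.RingTheory.HilbertSamuel
open Summit.ResolutionOfSingularities.ResolutionOfSingularities.Theorems.CampaignW42
open Summit.ResolutionOfSingularities.ResolutionOfSingularities.Theorems.SigmaMaxModificationsCorridor3.Sigma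
open Summit.ResolutionOfSingularities.ResolutionOfSingularities.Theorems.SigmaMaxModificationsCorridor3.Helpers

namespace Summit.ResolutionOfSingularities.ResolutionOfSingularities.Theorems.SigmaMaxModificationsCorridor3.Moving

set_option maxHeartbeats 400000 in
/-- [OURS · L1 W4.2] **E-adapted CP frames along the boundary-threaded canonical chain, the face-reading binder asked only at steps THROUGH the
marked point, WITH the permissibility of the centre there supplied to it.** See the module docstring. [cite: CossartPiltant2019, Def. 2.6–2.7 and Prop. 2.7 (arXiv v1 p. 14)] [cite: CossartJannsenSaito2020, Rem. 6.29 (1)] -/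
theorem exists_isCPFrame_adapted_of_reachesσE_through' {p : ℕ} {R₀ : ∀ S : Scheme.{0}, CentreSeq S → Prop}
    (hRf : OracleFunctional R₀) (hRa : OracleAdmissible R₀) {ν : ℕ → ℕ} {X₀ : Scheme.{0}} [IsLocallyNoetherian X₀] {x : X₀}
    (hX : IsMaximalOrigin p 3 ν X₀ x) (E₀ : Boundary X₀)
    (hread : ∀ s : MarkedStageE.{0}, ReachesσE (Strategy.cjs R₀).withBoundary 3 ν (MarkedStageE.init X₀ x E₀) s →
      ∀ (C : s.W.IdealSheafData) (P' : Option (Pending (blowup C))), IsCanonicalStep R₀ 3 ν s.L s.P C P' →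
      s.pt ∈ (C.support : Set s.W) → IdealSheafData.IsPermissibleAt C s.pt →
      ∀ (R : Type) (_ : CommRing R) (_ : IsLocalRing R) (u : Fin 3 → R) (h : R[X])
        (φ : (s.W.presheaf.stalk s.pt : Type) →+* R[X] ⧸ Ideal.span {h}) (e : s.W.IdealSheafData → Fin 3),
        IsCPFrame s.toMarkedStage R u h φ → IsAdicComplete (maximalIdeal R) R →
        (∀ i < h.natDegree, h.coeff i ∈ maximalIdeal R ^ (h.natDegree - i)) →
        (∀ I ∈ membersThrough s.E s.pt, (stalkIdeal I s.pt).map φ = Ideal.span {Ideal.Quotient.mk _ (Polynomial.C (u (e I)))}) →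
        ∃ T : Finset (Fin 3),
          (stalkIdeal C s.pt).map φ =
            ((Ideal.span (u '' ↑T)).map (Polynomial.C : R →+* R[X]) ⊔ Ideal.span {X}).map (Ideal.Quotient.mk (Ideal.span {h})) ∧
          ∀ i ∈ Finset.Icc 1 h.natDegree, h.coeff (h.natDegree - i) ∈ Ideal.span (u '' ↑T) ^ i)
    (h0 : ∃ (R : Type) (_ : CommRing R) (_ : IsLocalRing R) (u : Fin 3 → R) (h : R[X])
      (φ : ((MarkedStageE.init X₀ x E₀).W.presheaf.stalk (MarkedStageE.init X₀ x E₀).pt : Type) →+* R[X] ⧸ Ideal.span {h})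
      (e : (MarkedStageE.init X₀ x E₀).W.IdealSheafData → Fin 3),
      IsCPFrame (MarkedStageE.init X₀ x E₀).toMarkedStage R u h φ ∧ IsAdicComplete (maximalIdeal R) R ∧
      (∀ i < h.natDegree, h.coeff i ∈ maximalIdeal R ^ (h.natDegree - i)) ∧
      ∀ I ∈ membersThrough (MarkedStageE.init X₀ x E₀).E (MarkedStageE.init X₀ x E₀).pt,
        (stalkIdeal I (MarkedStageE.init X₀ x E₀).pt).map φ = Ideal.span {Ideal.Quotient.mk _ (Polynomial.C (u (e I)))})
    {s : MarkedStageE.{0}} (hs : ReachesσE (Strategy.cjs R₀).withBoundary 3 ν (MarkedStageE.init X₀ x E₀) s) :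
    ∃ (R : Type) (_ : CommRing R) (_ : IsLocalRing R) (u : Fin 3 → R) (h : R[X])
      (φ : (s.W.presheaf.stalk s.pt : Type) →+* R[X] ⧸ Ideal.span {h}) (e : s.W.IdealSheafData → Fin 3),
      IsCPFrame s.toMarkedStage R u h φ ∧ IsAdicComplete (maximalIdeal R) R ∧
      (∀ i < h.natDegree, h.coeff i ∈ maximalIdeal R ^ (h.natDegree - i)) ∧
      ∀ I ∈ membersThrough s.E s.pt, (stalkIdeal I s.pt).map φ = Ideal.span {Ideal.Quotient.mk _ (Polynomial.C (u (e I)))} := by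
  classical
  induction hs with
  | refl => exact h0
  | tail hs' hstep ih =>
    rename_i s₁ s₂
    obtain ⟨R, _, _, u, h, φ, e, hF, hcpl, hco, hE⟩ := ih
    have hstep' := hstep
    obtain ⟨C, P', hln', x', hσ, hx', hcl, hstr, rfl⟩ := hstep'
    have hcs : IsCanonicalStep R₀ 3 ν s₁.L s₁.P C P' := by
      rw [Strategy.withBoundary_step_iff, Strategy.cjs_step] at hσ
      exact hσ
    haveI : IsLocallyNoetherian s₁.W := s₁.ln
    haveI : IsLocallyNoetherian (blowup C) := hln'
    by_cases hmemC : s₁.pt ∈ (C.support : Set s₁.W)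
    · -- GENUINE step: the E-adapted propagation (p-PropagationAdapted) in the face read by `hread`
      have hperm : IdealSheafData.IsPermissibleAt C s₁.pt :=
        isPermissibleAt_of_isCanonicalStep_of_mem hRf hRa hX (reaches_of_reachesσE_cjs hs') C P' hln' x' hcs hx' hcl hstr hmemC
      obtain ⟨T, hJ, hcoT⟩ := hread _ hs' C P' hcs hmemC hperm R inferInstance inferInstance u h φ e hF hcpl hco hE
      obtain ⟨R', _, _, u', h', φ', j₀, hF', hcpl', -, hco', -, hexc, hmem⟩ :=
        hF.exists_isCPFrame_blowup_adapted hRf hRa hX (reaches_of_reachesσE_cjs hs') C P' hln' x' hcs hx' hcl hstr T hJ hcoT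
      -- the new reading: transforms keep their index, the exceptional member reads `j₀`
      let e' : (blowup C).IdealSheafData → Fin 3 := fun J =>
        if J = C.comap (blowup.π C) then j₀
        else if hJ : ∃ I, I ∈ membersThrough s₁.E s₁.pt ∧ Boundary.memberTransform C I = J then e hJ.choose else 0
      refine ⟨R', inferInstance, inferInstance, u', h', φ', e', hF', hcpl', hco', fun J hJm => ?_⟩
      obtain ⟨hJE, hxJ⟩ := mem_membersThrough_iff.mp hJm
      by_cases hJexc : J = C.comap (blowup.π C)
      · have he' : e' J = j₀ := by simp only [e', hJexc, if_true]
        rw [he', hJexc]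
        exact hexc
      · rcases (Boundary.mem_next_iff s₁.E C J).mp hJE with ⟨I, hIE, hIJ⟩ | hJ'
        swap
        · exact absurd hJ' hJexc
        have hxI : s₁.pt ∈ (I.support : Set s₁.W) := by
          have := Boundary.support_memberTransform_subset C I (hIJ ▸ hxJ)
          rw [Set.mem_preimage, hx'] at this
          exact this
        have hex : ∃ I, I ∈ membersThrough s₁.E s₁.pt ∧ Boundary.memberTransform C I = J :=
          ⟨I, mem_membersThrough_iff.mpr ⟨hIE, hxI⟩, hIJ⟩
        have he' : e' J = e hex.choose := by simp only [e', hJexc, if_false, dif_pos hex]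
        obtain ⟨hI₁m, hI₁J⟩ := hex.choose_spec
        rcases hmem hex.choose (e hex.choose) (hE _ hI₁m) with htop | ⟨-, hread'⟩
        · exfalso
          have hne := (mem_support_iff_stalkIdeal_ne_top J x').mp hxJ
          rw [← hI₁J] at hne
          exact hne htop
        · rw [he']
          show (stalkIdeal J x').map φ' = _
          have hJ' : stalkIdeal J x' = stalkIdeal (Boundary.memberTransform C hex.choose) x' := by rw [hI₁J]
          rw [hJ']
          exact hread'
    · -- WAITING step: the frame passes unchanged, transforms keep their reading, the exceptional member misses `x'`
      obtain ⟨φ', hF', -, htop, hK⟩ := hF.exists_isCPFrame_blowup_waiting ν C P' hln' x' hx' hmemC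
      let e' : (blowup C).IdealSheafData → Fin 3 := fun J =>
        if hJ : ∃ I, I ∈ membersThrough s₁.E s₁.pt ∧ Boundary.memberTransform C I = J then e hJ.choose else 0
      refine ⟨R, inferInstance, inferInstance, u, h, φ', e', hF', hcpl, hco, fun J hJm => ?_⟩
      obtain ⟨hJE, hxJ⟩ := mem_membersThrough_iff.mp hJm
      have hne := (mem_support_iff_stalkIdeal_ne_top J x').mp hxJ
      rcases (Boundary.mem_next_iff s₁.E C J).mp hJE with ⟨I, hIE, hIJ⟩ | hJ'
      swap
      · exfalso
        rw [hJ'] at hne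
        exact hne htop
      have hxI : s₁.pt ∈ (I.support : Set s₁.W) := by
        have := Boundary.support_memberTransform_subset C I (hIJ ▸ hxJ)
        rw [Set.mem_preimage, hx'] at this
        exact this
      have hex : ∃ I, I ∈ membersThrough s₁.E s₁.pt ∧ Boundary.memberTransform C I = J :=
        ⟨I, mem_membersThrough_iff.mpr ⟨hIE, hxI⟩, hIJ⟩
      have he' : e' J = e hex.choose := by simp only [e', dif_pos hex]
      obtain ⟨hI₁m, hI₁J⟩ := hex.choose_spec
      rw [he']
      show (stalkIdeal J x').map φ' = _
      have hJ'' : stalkIdeal J x' = stalkIdeal (Boundary.memberTransform C hex.choose) x' := by rw [hI₁J]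
      rw [hJ'']
      exact (hK hex.choose).trans (hE _ hI₁m)

/-- [OURS · L1 W4.2] **D18 `hread_menu` DISCHARGED — final packaging.** See the module docstring.
[cite: CossartPiltant2019, Def. 2.6–2.7, Prop. 2.3–2.4, Prop. 2.7 (arXiv v1 pp. 11–14)] [cite: CossartJannsenSaito2020, Def. 3.1, Rem. 6.29 (1)] -/
theorem exists_isCPFrame_adapted_of_reachesσE_through_of_faces {p : ℕ} {R₀ : ∀ S : Scheme.{0}, CentreSeq S → Prop}
    (hRf : OracleFunctional R₀) (hRa : OracleAdmissible R₀) {ν : ℕ → ℕ} {X₀ : Scheme.{0}} [IsLocallyNoetherian X₀] {x : X₀}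
    (hX : IsMaximalOrigin p 3 ν X₀ x) (E₀ : Boundary X₀)
    (hface : ∀ s : MarkedStageE.{0}, ReachesσE (Strategy.cjs R₀).withBoundary 3 ν (MarkedStageE.init X₀ x E₀) s →
      ∀ (C : s.W.IdealSheafData) (P' : Option (Pending (blowup C))), IsCanonicalStep R₀ 3 ν s.L s.P C P' →
      s.pt ∈ (C.support : Set s.W) →
      ∃ K : Finset s.W.IdealSheafData, (∀ I ∈ K, I ∈ membersThrough s.E s.pt ∧ stalkIdeal I s.pt ≤ stalkIdeal C s.pt) ∧
        (∀ I ∈ K, ∀ I' ∈ K, stalkIdeal I s.pt = stalkIdeal I' s.pt → I = I') ∧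
        ringKrullDim ((s.W.presheaf.stalk s.pt : Type) ⧸ stalkIdeal C s.pt) + K.card = 3)
    (h0 : ∃ (R : Type) (_ : CommRing R) (_ : IsLocalRing R) (u : Fin 3 → R) (h : R[X])
      (φ : ((MarkedStageE.init X₀ x E₀).W.presheaf.stalk (MarkedStageE.init X₀ x E₀).pt : Type) →+* R[X] ⧸ Ideal.span {h})
      (e : (MarkedStageE.init X₀ x E₀).W.IdealSheafData → Fin 3),
      IsCPFrame (MarkedStageE.init X₀ x E₀).toMarkedStage R u h φ ∧ IsAdicComplete (maximalIdeal R) R ∧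
      (∀ i < h.natDegree, h.coeff i ∈ maximalIdeal R ^ (h.natDegree - i)) ∧
      ∀ I ∈ membersThrough (MarkedStageE.init X₀ x E₀).E (MarkedStageE.init X₀ x E₀).pt,
        (stalkIdeal I (MarkedStageE.init X₀ x E₀).pt).map φ = Ideal.span {Ideal.Quotient.mk _ (Polynomial.C (u (e I)))})
    {s : MarkedStageE.{0}} (hs : ReachesσE (Strategy.cjs R₀).withBoundary 3 ν (MarkedStageE.init X₀ x E₀) s) :
    ∃ (R : Type) (_ : CommRing R) (_ : IsLocalRing R) (u : Fin 3 → R) (h : R[X])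
      (φ : (s.W.presheaf.stalk s.pt : Type) →+* R[X] ⧸ Ideal.span {h}) (e : s.W.IdealSheafData → Fin 3),
      IsCPFrame s.toMarkedStage R u h φ ∧ IsAdicComplete (maximalIdeal R) R ∧
      (∀ i < h.natDegree, h.coeff i ∈ maximalIdeal R ^ (h.natDegree - i)) ∧
      ∀ I ∈ membersThrough s.E s.pt, (stalkIdeal I s.pt).map φ = Ideal.span {Ideal.Quotient.mk _ (Polynomial.C (u (e I)))} := by
  classical
  refine exists_isCPFrame_adapted_of_reachesσE_through' hRf hRa hX E₀
    (fun s₁ hs₁ C P' hcs hmem hperm R _ _ u h φ e hF hcpl hco hE => ?_) h0 hs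
  obtain ⟨K, hK, hKinj, hdimK⟩ := hface s₁ hs₁ C P' hcs hmem
  have hF' := hF
  obtain ⟨hR, hloc, hdim, hu, hmon, hφl, hflat, hmap, -, hmin⟩ := hF'
  haveI := hR
  haveI : IsLocalRing (AdjoinRoot h) := hloc
  -- the face indices `T = e(K)`; `e` is injective on `K` (faithful flatness of `φ`)
  letI algφ : Algebra (s₁.W.presheaf.stalk s₁.pt : Type) (R[X] ⧸ Ideal.span {h}) := φ.toAlgebra
  haveI : Module.Flat (s₁.W.presheaf.stalk s₁.pt : Type) (R[X] ⧸ Ideal.span {h}) := hflat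
  haveI : IsLocalHom (algebraMap (s₁.W.presheaf.stalk s₁.pt : Type) (R[X] ⧸ Ideal.span {h})) := hφl
  haveI : Module.FaithfullyFlat (s₁.W.presheaf.stalk s₁.pt : Type) (R[X] ⧸ Ideal.span {h}) := Module.FaithfullyFlat.of_flat_of_isLocalHom
  set T : Finset (Fin 3) := K.image e with hTdef
  have heinj : Set.InjOn e ↑K := by
    intro I hI I' hI' hee
    apply hKinj I (Finset.mem_coe.mp hI) I' (Finset.mem_coe.mp hI')
    have h1 := hE I (hK I (Finset.mem_coe.mp hI)).1
    have h2 := hE I' (hK I' (Finset.mem_coe.mp hI')).1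
    rw [← Ideal.comap_map_eq_self_of_faithfullyFlat (B := R[X] ⧸ Ideal.span {h}) (stalkIdeal I s₁.pt),
      ← Ideal.comap_map_eq_self_of_faithfullyFlat (B := R[X] ⧸ Ideal.span {h}) (stalkIdeal I' s₁.pt)]
    change (Ideal.map φ (stalkIdeal I s₁.pt)).comap φ = (Ideal.map φ (stalkIdeal I' s₁.pt)).comap φ
    rw [h1, h2, hee]
  have hTcard : T.card = K.card := Finset.card_image_of_injOn heinj
  have hT : ∀ t ∈ T, Ideal.Quotient.mk (Ideal.span {h}) (Polynomial.C (u t)) ∈ (stalkIdeal C s₁.pt).map φ := by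
    intro t ht
    obtain ⟨I, hIK, rfl⟩ := Finset.mem_image.mp ht
    have h1 := hE I (hK I hIK).1
    exact Ideal.map_mono (hK I hIK).2 (h1 ▸ Ideal.mem_span_singleton_self _)
  have hdimC : ringKrullDim ((s₁.W.presheaf.stalk s₁.pt : Type) ⧸ stalkIdeal C s₁.pt) + T.card = 3 := by rw [hTcard]; exact hdimK
  exact ⟨T, hF.exists_reading_of_face (hF.natCast_eq_zero_or_isUnit hco (natCast_eq_zero_or_isUnit_stalk_of_reachesσE hX E₀ hs₁))
    hco C hperm T hT hdimC⟩

end Summit.ResolutionOfSingularities.ResolutionOfSingularities.Theorems.SigmaMaxModificationsCorridor3.Moving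

end
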